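import Summits.Parity.GeneralizedHardyLittlewood.Theorems.ChenParityOracleBLAPHostParityFromBrickTypeIBDHLarge
import HarnessLib

/-!
# Route `ChenParityOracleBLAP` — crux S1 = `HostParityFromBrick` (stmt-Parity-20045): Barban–Davenport–Halberstam for `λ` on initial segments

Support file for the prime half `K1 → K2 → HP1` of S1 (the unconditional Type-I input, large
moduli).  From BFI's Theorem 0 (`BombieriFriedlanderIwaniecTheorem0a_classic`, the large sieve form
of the Barban–Davenport–Halberstam theorem for sequences with (A₂)) and (A₂) for `λ`
(`siegelWalfiszHyp_liouville`), the mean square of the Liouville function in reduced classes over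
INITIAL SEGMENTS:
`∑_{q ≤ Q} ∑_{(l,q)=1} |∑_{v ≤ V, v ≡ l (q)} λ(v)|² ≤ C X²/(log X)^A` for `X ≥ X₀`, `Q ≤ X^{3/4}`,
`V ≤ X` (`bdh_liouville_initial`): `[1, V]` is a union of `≤ 2 log X` dyadic blocks; blocks above
`X^{7/8}` by Theorem 0 plus the coprime mean `∑_{n ∼ N, (n,q)=1} λ(n)` (Möbius and the prime number
theorem for `λ`, i.e. Siegel–Walfisz with `q = 1`), blocks below `X^{7/8}` trivially.

References: E. Bombieri, J. B. Friedlander, H. Iwaniec, Acta Math. 156 (1986), Theorem 0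
[BombieriFriedlanderIwaniecActa1986]; H. L. Montgomery, R. C. Vaughan, *Multiplicative Number
Theory I* (2007), §17 [MontgomeryVaughan2007].
-/

namespace Summit.Parity.GeneralizedHardyLittlewood.Theorems

open Finset Real
open scoped ArithmeticFunction.sigma
open ArithmeticFunction (liouville)
open Literature.NumberTheory.Sieve Literature.NumberTheory.Sieve.BFI

/-! ### The theorem -/

set_option maxHeartbeats 800000 in
-- the assembled term (many `set` abbreviations over a long dyadic decomposition) needs more than the
-- default budget at declaration-compilation time; every tactic step is individually cheap.
/-- **Barban–Davenport–Halberstam for `λ` over initial segments.**  For every `A > 0` there are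
`C > 0`, `X₀` such that for all `X ≥ X₀`, `Q ≤ X^{3/4}` and `V ≤ X`:
`∑_{q ≤ Q} ∑_{(l,q)=1} (∑_{v ≤ V, v ≡ l (q)} λ(v))² ≤ C X²/(log X)^A`. -/
theorem bdh_liouville_initial (A : ℝ) (hA : 0 < A) :
    ∃ C X₀ : ℝ, 0 < C ∧ ∀ X : ℝ, X₀ ≤ X → ∀ Q : ℕ, (Q : ℝ) ≤ X ^ (3 / 4 : ℝ) → ∀ V : ℕ, (V : ℝ) ≤ X →
      ∑ q ∈ Icc 1 Q, ∑ l ∈ (range q).filter (fun l => l.Coprime q),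
        (∑ v ∈ (Icc 1 V).filter (fun v : ℕ => (v : ZMod q) = (l : ZMod q)), (liouville v : ℝ)) ^ 2 ≤
        C * X ^ 2 / Real.log X ^ A := by
  classical
  obtain ⟨Csw, hCsw⟩ := siegelWalfiszHyp_liouville
  obtain ⟨C₀, N₁, h0a⟩ := BombieriFriedlanderIwaniecTheorem0a_classic (A := A + 2) (by positivity)
    (B := 2) (by norm_num) Csw
  set B : ℝ := A / 2 + 9 with hBdef
  obtain ⟨Cm, hCm0, hCm⟩ := abs_coprime_mean_liouville_le B (by positivity)
  obtain ⟨Cτ, hCτ, hτ⟩ := exists_sum_sigma_zero_pow_div_totient_le_real 2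
  set C₀' := max C₀ 0 with hC₀'
  set K₁ : ℝ := 6 * C₀' * (8 / 7) ^ (A + 2) + 4 * Cm ^ 2 * Cτ * (8 / 7) ^ (A + 18) with hK₁
  set K₂ : ℝ := 4 * Cm ^ 2 * Cτ with hK₂
  have hK₁0 : 0 ≤ K₁ := by positivity
  have hK₂0 : 0 ≤ K₂ := by positivity
  -- eventually-in-`X` facts
  have hev : ∀ᶠ X : ℝ in Filter.atTop, 16 ≤ X ∧ max N₁ 9 ≤ X ^ (7 / 8 : ℝ) ∧
      Real.log X ^ (2 * A + 8) ≤ X ^ (1 / 8 : ℝ) ∧ Real.log X ^ (A + 17) ≤ X ^ (1 / 4 : ℝ) := by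
    refine (Filter.eventually_ge_atTop 16).and ((((tendsto_rpow_atTop (by norm_num : (0:ℝ) < 7 / 8)).eventually_ge_atTop _)).and ?_)
    have h1 := (isLittleO_log_rpow_rpow_atTop (2 * A + 8) (by norm_num : (0:ℝ) < 1 / 8)).bound one_pos
    have h2 := (isLittleO_log_rpow_rpow_atTop (A + 17) (by norm_num : (0:ℝ) < 1 / 4)).bound one_pos
    filter_upwards [h1, h2, Filter.eventually_ge_atTop (1 : ℝ)] with X hX1 hX2 hX
    have hl : 0 ≤ Real.log X := Real.log_nonneg hX
    rw [Real.norm_of_nonneg (Real.rpow_nonneg hl _), Real.norm_of_nonneg (Real.rpow_nonneg (by linarith) _),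
      one_mul] at hX1 hX2
    exact ⟨hX1, hX2⟩
  obtain ⟨X₀, hX₀⟩ := Filter.eventually_atTop.mp hev
  refine ⟨K₁ + 3 * K₂ + 163, X₀, by positivity, ?_⟩
  intro X hX Q hQ V hV
  obtain ⟨hX16, hX78, hE3, hE4⟩ := hX₀ X hX
  have hX1 : 1 ≤ X := by linarith
  have hX0 : 0 < X := by linarith
  set L := Real.log X with hL
  have hL2 : 2 ≤ L := by
    rw [hL]
    have : Real.exp 2 ≤ X := by
      have h2 : Real.exp 2 = Real.exp 1 * Real.exp 1 := by rw [← Real.exp_add]; norm_num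
      rw [h2]; nlinarith [Real.exp_one_lt_d9, Real.exp_one_gt_d9]
    calc (2 : ℝ) = Real.log (Real.exp 2) := (Real.log_exp 2).symm
      _ ≤ Real.log X := Real.log_le_log (Real.exp_pos 2) this
  have hL1 : 1 ≤ L := by linarith
  have hL0 : 0 < L := by linarith
  have hLpow : ∀ c : ℝ, 0 < L ^ c := fun c => Real.rpow_pos_of_pos hL0 c
  have hN₁X : N₁ ≤ X ^ (7 / 8 : ℝ) := (le_max_left _ _).trans hX78
  have h9X : 9 ≤ X ^ (7 / 8 : ℝ) := (le_max_right _ _).trans hX78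
  have hX78le : X ^ (7 / 8 : ℝ) ≤ X := by
    conv_rhs => rw [← Real.rpow_one X]
    exact Real.rpow_le_rpow_of_exponent_le hX1 (by norm_num)
  have hQX : (Q : ℝ) ≤ X := hQ.trans (by
    conv_rhs => rw [← Real.rpow_one X]
    exact Real.rpow_le_rpow_of_exponent_le hX1 (by norm_num))
  -- the target is nonnegative
  have hRHS0 : 0 ≤ (K₁ + 3 * K₂ + 163) * X ^ 2 / Real.log X ^ A := by positivity
  -- the case `V = 0`
  rcases Nat.eq_zero_or_pos V with hV0 | hVpos
  · subst hV0
    simp only [show Icc 1 0 = (∅ : Finset ℕ) by rfl, Finset.filter_empty, Finset.sum_empty]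
    simpa using hRHS0
  -- dyadic blocks
  set J : ℕ := Nat.log 2 V + 1 with hJdef
  have hJ : V < 2 ^ J := Nat.lt_pow_succ_log_self (by norm_num) V
  have hV1 : (1 : ℝ) ≤ V := by exact_mod_cast hVpos
  have hJle : (J : ℝ) ≤ 3 * L := by
    have h1 : ((2 ^ Nat.log 2 V : ℕ) : ℝ) ≤ V := by exact_mod_cast Nat.pow_log_le_self 2 (by omega)
    have h2 : (Nat.log 2 V : ℝ) * Real.log 2 ≤ Real.log V := by
      have := Real.log_le_log (by positivity) h1
      push_cast at this
      rwa [Real.log_pow] at this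
    have h3 : Real.log V ≤ L := by rw [hL]; exact Real.log_le_log (by linarith) hV
    have h4 : (Nat.log 2 V : ℝ) ≤ 2 * L := by
      have hl2 : (1 : ℝ) / 2 < Real.log 2 := by linarith [Real.log_two_gt_d9]
      have hl0 : (0 : ℝ) ≤ Nat.log 2 V := Nat.cast_nonneg _
      nlinarith
    rw [hJdef]; push_cast; linarith
  set Bk : ℕ → ℕ → ℕ → ℝ := fun j q l =>
    ∑ v ∈ dyadic ((V : ℝ) / 2 ^ (j + 1)), if (v : ZMod q) = (l : ZMod q) then (liouville v : ℝ) else 0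
    with hBk
  have hdecomp : ∀ q l : ℕ, ∑ v ∈ (Icc 1 V).filter (fun v : ℕ => (v : ZMod q) = (l : ZMod q)),
      (liouville v : ℝ) = ∑ j ∈ range J, Bk j q l := by
    intro q l
    rw [Finset.sum_filter]
    exact sum_Icc_eq_sum_dyadic_blocks hJ _
  -- Theorem 0 specialised to `λ`
  have h0lam : ∀ N : ℝ, N₁ ≤ N → 4 ≤ N → ∀ Q' : ℝ, Q' ≤ N / Real.log N ^ (2 * (A + 2) + 4) →
      ∑ q ∈ Icc 1 ⌊Q'⌋₊, ∑ l ∈ (range q).filter (fun l => l.Coprime q),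
        ((∑ n ∈ dyadic N, if (n : ZMod q) = (l : ZMod q) then (liouville n : ℝ) else 0) -
          (∑ n ∈ dyadic N, if n.Coprime q then (liouville n : ℝ) else 0) / (Nat.totient q : ℝ)) ^ 2 ≤
        C₀ * l2Sq N (fun n => (liouville n : ℝ)) * N / Real.log N ^ (A + 2) :=
    fun N hN hN4 Q' hQ' => h0a N hN (fun n => (liouville n : ℝ)) (hCsw N hN4) Q' hQ'
  have hτX := hτ X (by linarith)
  -- per-block bound
  have hblock : ∀ j ∈ range J, ∑ q ∈ Icc 1 Q, ∑ l ∈ (range q).filter (fun l => l.Coprime q),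
      Bk j q l ^ 2 ≤ K₁ * ((V : ℝ) / 2 ^ (j + 1)) ^ 2 / L ^ (A + 2) + K₂ * L ^ 16 * ((V : ℝ) / 2 ^ (j + 1)) +
        (8 * X ^ (7 / 4 : ℝ) * (L + 1) + 2 * X ^ (3 / 2 : ℝ)) := by
    intro j _
    have hN0 : 0 ≤ (V : ℝ) / 2 ^ (j + 1) := by positivity
    have hNX : (V : ℝ) / 2 ^ (j + 1) ≤ X :=
      le_trans (div_le_self (by positivity) (one_le_pow₀ (by norm_num))) hV
    have hsmall0 : 0 ≤ 8 * X ^ (7 / 4 : ℝ) * (L + 1) + 2 * X ^ (3 / 2 : ℝ) := by positivity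
    have hbig0 : 0 ≤ K₁ * ((V : ℝ) / 2 ^ (j + 1)) ^ 2 / L ^ (A + 2) +
        K₂ * L ^ 16 * ((V : ℝ) / 2 ^ (j + 1)) := by positivity
    by_cases hbig : X ^ (7 / 8 : ℝ) ≤ (V : ℝ) / 2 ^ (j + 1)
    · have hN9 : 9 ≤ (V : ℝ) / 2 ^ (j + 1) := h9X.trans hbig
      have hlarge := bdh_block_large (N := (V : ℝ) / 2 ^ (j + 1)) hA hX16 hE3 hQ hQX hNX hbig hN9
        (le_max_left C₀ 0) (le_max_right C₀ 0) hCm0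
        (fun Q' hQ' => h0lam _ (hN₁X.trans hbig) (by linarith only [hN9]) Q' hQ')
        (fun q hq => hCm _ hN9 q hq) hτX
      simp only [hBk]
      rw [← hK₁, ← hK₂, ← hL] at hlarge
      exact hlarge.trans (le_add_of_nonneg_right hsmall0)
    · -- a small block
      push Not at hbig
      have htriv := sum_sq_dyadic_class_trivial hN0 Q
      simp only [hBk]
      refine le_trans (le_trans htriv ?_) (le_add_of_nonneg_left hbig0)
      have hN2 : ((V : ℝ) / 2 ^ (j + 1)) ^ 2 ≤ X ^ (7 / 4 : ℝ) := by
        calc ((V : ℝ) / 2 ^ (j + 1)) ^ 2 ≤ (X ^ (7 / 8 : ℝ)) ^ 2 := pow_le_pow_left₀ hN0 hbig.le 2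
          _ = X ^ (7 / 4 : ℝ) := by rw [← Real.rpow_natCast, ← Real.rpow_mul hX0.le]; norm_num
      have hlogQ : Real.log Q ≤ L := by
        rcases Nat.eq_zero_or_pos Q with hQ0 | hQpos
        · rw [hQ0, Nat.cast_zero, Real.log_zero]; exact hL0.le
        · rw [hL]; exact Real.log_le_log (by exact_mod_cast hQpos) hQX
      have hQ2 : (Q : ℝ) ^ 2 ≤ X ^ (3 / 2 : ℝ) := by
        calc (Q : ℝ) ^ 2 ≤ (X ^ (3 / 4 : ℝ)) ^ 2 := pow_le_pow_left₀ (Nat.cast_nonneg _) hQ 2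
          _ = X ^ (3 / 2 : ℝ) := by rw [← Real.rpow_natCast, ← Real.rpow_mul hX0.le]; norm_num
      have hlogQ1 : 0 ≤ Real.log Q + 1 := by
        rcases Nat.eq_zero_or_pos Q with hQ0 | hQpos
        · rw [hQ0, Nat.cast_zero, Real.log_zero]; norm_num
        · linarith [Real.log_nonneg (show (1:ℝ) ≤ Q by exact_mod_cast hQpos)]
      have hx74 : 0 ≤ X ^ (7 / 4 : ℝ) := by positivity
      have hm := mul_le_mul hN2 (show Real.log Q + 1 ≤ L + 1 by linarith only [hlogQ]) hlogQ1 hx74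
      linarith only [hm, hQ2]
  -- assemble
  have hsq : ∀ q l : ℕ, (∑ j ∈ range J, Bk j q l) ^ 2 ≤ J * ∑ j ∈ range J, Bk j q l ^ 2 := by
    intro q l
    have := sq_sum_le_card_mul_sum_sq (s := range J) (f := fun j => Bk j q l)
    rwa [Finset.card_range] at this
  obtain ⟨hsum2, hsum1⟩ := sum_blocks_le (V : ℝ) (by positivity) J
  set S : ℝ := 8 * X ^ (7 / 4 : ℝ) * (L + 1) + 2 * X ^ (3 / 2 : ℝ) with hSdef
  have hS0 : 0 ≤ S := by positivity
  -- rpow bookkeeping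
  have hLadd : ∀ a b : ℝ, L ^ a * L ^ b = L ^ (a + b) := fun a b => (Real.rpow_add hL0 a b).symm
  have hLnat : ∀ n : ℕ, L ^ n = L ^ (n : ℝ) := fun n => (Real.rpow_natCast L n).symm
  have hX14 : X ^ (1 / 4 : ℝ) ≤ X := by
    conv_rhs => rw [← Real.rpow_one X]
    exact Real.rpow_le_rpow_of_exponent_le hX1 (by norm_num)
  have hLA17 : L ^ (A + 17) ≤ X := hE4.trans hX14
  have hV2 : (V : ℝ) ^ 2 ≤ X ^ 2 := pow_le_pow_left₀ (by positivity) hV 2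
  -- the sum over blocks
  have hsumblocks : ∑ j ∈ range J, (K₁ * ((V : ℝ) / 2 ^ (j + 1)) ^ 2 / L ^ (A + 2) +
      K₂ * L ^ 16 * ((V : ℝ) / 2 ^ (j + 1)) + S) ≤
      K₁ / L ^ (A + 2) * ((V : ℝ) ^ 2 / 3) + K₂ * L ^ 16 * V + J * S := by
    have hs1 : ∑ j ∈ range J, K₁ * ((V : ℝ) / 2 ^ (j + 1)) ^ 2 / L ^ (A + 2) =
        K₁ / L ^ (A + 2) * ∑ j ∈ range J, ((V : ℝ) / 2 ^ (j + 1)) ^ 2 := by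
      rw [Finset.mul_sum]; exact Finset.sum_congr rfl fun j _ => by ring
    have hs2 : ∑ j ∈ range J, K₂ * L ^ 16 * ((V : ℝ) / 2 ^ (j + 1)) =
        K₂ * L ^ 16 * ∑ j ∈ range J, (V : ℝ) / 2 ^ (j + 1) := by rw [Finset.mul_sum]
    have hs3 : ∑ _j ∈ range J, S = J * S := by rw [Finset.sum_const, Finset.card_range, nsmul_eq_mul]
    rw [Finset.sum_add_distrib, Finset.sum_add_distrib, hs1, hs2, hs3]
    have hK₁L : 0 ≤ K₁ / L ^ (A + 2) := by positivity
    have hK₂L : 0 ≤ K₂ * L ^ 16 := by positivity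
    gcongr
  -- the three final terms
  have t1 : 3 * L * (K₁ / L ^ (A + 2) * ((V : ℝ) ^ 2 / 3)) ≤ K₁ * X ^ 2 / L ^ A := by
    have hLA2 : L ^ (A + 2) = L ^ A * L ^ 2 := by rw [← hLadd, Real.rpow_two]
    have e : 3 * L * (K₁ / L ^ (A + 2) * ((V : ℝ) ^ 2 / 3)) = K₁ * (V : ℝ) ^ 2 / (L ^ A * L) := by
      rw [hLA2]; field_simp
    rw [e]
    calc K₁ * (V : ℝ) ^ 2 / (L ^ A * L) ≤ K₁ * X ^ 2 / (L ^ A * L) :=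
          div_le_div_of_nonneg_right (mul_le_mul_of_nonneg_left hV2 hK₁0) (by positivity)
      _ ≤ K₁ * X ^ 2 / L ^ A :=
          div_le_div_of_nonneg_left (by positivity) (hLpow A) (le_mul_of_one_le_right (hLpow A).le hL1)
  have t2 : 3 * L * (K₂ * L ^ 16 * V) ≤ 3 * K₂ * X ^ 2 / L ^ A := by
    rw [le_div_iff₀ (hLpow A)]
    have i17 : L * L ^ (16 : ℕ) * L ^ A = L ^ (A + 17) := by
      rw [hLnat 16]
      calc L * L ^ ((16 : ℕ) : ℝ) * L ^ A = L ^ (1 : ℝ) * L ^ ((16 : ℕ) : ℝ) * L ^ A := by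
            rw [Real.rpow_one]
        _ = L ^ ((1 : ℝ) + (16 : ℕ) + A) := by rw [hLadd, hLadd]
        _ = L ^ (A + 17) := by push_cast; ring_nf
    calc 3 * L * (K₂ * L ^ 16 * V) * L ^ A = 3 * K₂ * V * (L * L ^ (16 : ℕ) * L ^ A) := by ring
      _ = 3 * K₂ * V * L ^ (A + 17) := by rw [i17]
      _ ≤ 3 * K₂ * X * X :=
          mul_le_mul (mul_le_mul_of_nonneg_left hV (by positivity)) hLA17 (by positivity) (by positivity)
      _ = 3 * K₂ * X ^ 2 := by ring
  have t3 : 3 * L * ((3 * L) * S) ≤ 162 * X ^ 2 / L ^ A := by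
    rw [le_div_iff₀ (hLpow A)]
    have i3 : L ^ (3 : ℕ) * L ^ A = L ^ (A + 3) := by rw [hLnat 3, hLadd]; push_cast; ring_nf
    have hLA3 : L ^ (3 : ℕ) * L ^ A ≤ X ^ (1 / 4 : ℝ) := by
      rw [i3]; exact (Real.rpow_le_rpow_of_exponent_le hL1 (by linarith)).trans hE4
    have hX74 : X ^ (7 / 4 : ℝ) * X ^ (1 / 4 : ℝ) = X ^ 2 := by
      rw [← Real.rpow_add hX0]; norm_num
    have hX32 : X ^ (3 / 2 : ℝ) * X ^ (1 / 4 : ℝ) ≤ X ^ 2 := by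
      rw [← Real.rpow_add hX0]
      calc X ^ ((3 : ℝ) / 2 + 1 / 4) ≤ X ^ (2 : ℝ) := Real.rpow_le_rpow_of_exponent_le hX1 (by norm_num)
        _ = X ^ 2 := by norm_num
    have hx74 : 0 ≤ X ^ (7 / 4 : ℝ) := by positivity
    have hx32 : 0 ≤ X ^ (3 / 2 : ℝ) := by positivity
    have hL3 : L ^ (3 : ℕ) = L * L * L := by ring
    have hLLL : L * L ≤ L * L * L := le_mul_of_one_le_right (by positivity) hL1
    have hLL : L * L ≤ L ^ (3 : ℕ) := by rw [hL3]; exact hLLL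
    have hLL1 : L * L * (L + 1) ≤ 2 * L ^ (3 : ℕ) := by
      rw [hL3]
      have : L * L * (L + 1) = L * L * L + L * L := by ring
      rw [this]; linarith only [hLLL]
    have hstep : 3 * L * ((3 * L) * S) ≤ (144 * X ^ (7 / 4 : ℝ) + 18 * X ^ (3 / 2 : ℝ)) * L ^ (3 : ℕ) := by
      rw [hSdef]
      have e : 3 * L * ((3 * L) * (8 * X ^ (7 / 4 : ℝ) * (L + 1) + 2 * X ^ (3 / 2 : ℝ))) =
          72 * X ^ (7 / 4 : ℝ) * (L * L * (L + 1)) + 18 * X ^ (3 / 2 : ℝ) * (L * L) := by ring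
      rw [e]
      have a1 : 72 * X ^ (7 / 4 : ℝ) * (L * L * (L + 1)) ≤ 72 * X ^ (7 / 4 : ℝ) * (2 * L ^ (3 : ℕ)) :=
        mul_le_mul_of_nonneg_left hLL1 (by positivity)
      have a2 : 18 * X ^ (3 / 2 : ℝ) * (L * L) ≤ 18 * X ^ (3 / 2 : ℝ) * L ^ (3 : ℕ) :=
        mul_le_mul_of_nonneg_left hLL (by positivity)
      linarith only [a1, a2]
    calc 3 * L * ((3 * L) * S) * L ^ A ≤ (144 * X ^ (7 / 4 : ℝ) + 18 * X ^ (3 / 2 : ℝ)) * L ^ (3 : ℕ) * L ^ A :=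
          mul_le_mul_of_nonneg_right hstep (hLpow A).le
      _ = (144 * X ^ (7 / 4 : ℝ) + 18 * X ^ (3 / 2 : ℝ)) * (L ^ (3 : ℕ) * L ^ A) := by ring
      _ ≤ (144 * X ^ (7 / 4 : ℝ) + 18 * X ^ (3 / 2 : ℝ)) * X ^ (1 / 4 : ℝ) :=
          mul_le_mul_of_nonneg_left hLA3 (by positivity)
      _ = 144 * (X ^ (7 / 4 : ℝ) * X ^ (1 / 4 : ℝ)) + 18 * (X ^ (3 / 2 : ℝ) * X ^ (1 / 4 : ℝ)) := by ring
      _ ≤ 144 * X ^ 2 + 18 * X ^ 2 := by rw [hX74]; linarith only [hX32]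
      _ = 162 * X ^ 2 := by ring
  -- the main chain
  have hin0 : 0 ≤ K₁ / L ^ (A + 2) * ((V : ℝ) ^ 2 / 3) + K₂ * L ^ 16 * V + J * S := by positivity
  calc ∑ q ∈ Icc 1 Q, ∑ l ∈ (range q).filter (fun l => l.Coprime q),
        (∑ v ∈ (Icc 1 V).filter (fun v : ℕ => (v : ZMod q) = (l : ZMod q)), (liouville v : ℝ)) ^ 2
      = ∑ q ∈ Icc 1 Q, ∑ l ∈ (range q).filter (fun l => l.Coprime q), (∑ j ∈ range J, Bk j q l) ^ 2 := by
        simp_rw [hdecomp]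
    _ ≤ ∑ q ∈ Icc 1 Q, ∑ l ∈ (range q).filter (fun l => l.Coprime q), ((J : ℝ) * ∑ j ∈ range J, Bk j q l ^ 2) :=
        Finset.sum_le_sum fun q _ => Finset.sum_le_sum fun l _ => hsq q l
    _ = J * ∑ j ∈ range J, ∑ q ∈ Icc 1 Q, ∑ l ∈ (range q).filter (fun l => l.Coprime q), Bk j q l ^ 2 := by
        rw [Finset.mul_sum]
        simp_rw [Finset.mul_sum]
        rw [Finset.sum_comm]
        refine Finset.sum_congr rfl fun q _ => ?_
        rw [Finset.sum_comm]
    _ ≤ J * ∑ j ∈ range J, (K₁ * ((V : ℝ) / 2 ^ (j + 1)) ^ 2 / L ^ (A + 2) + K₂ * L ^ 16 * ((V : ℝ) / 2 ^ (j + 1)) + S) :=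
        mul_le_mul_of_nonneg_left (Finset.sum_le_sum hblock) (Nat.cast_nonneg _)
    _ ≤ (3 * L) * (K₁ / L ^ (A + 2) * ((V : ℝ) ^ 2 / 3) + K₂ * L ^ 16 * V + (3 * L) * S) := by
        calc (J : ℝ) * ∑ j ∈ range J, (K₁ * ((V : ℝ) / 2 ^ (j + 1)) ^ 2 / L ^ (A + 2) +
              K₂ * L ^ 16 * ((V : ℝ) / 2 ^ (j + 1)) + S)
            ≤ (J : ℝ) * (K₁ / L ^ (A + 2) * ((V : ℝ) ^ 2 / 3) + K₂ * L ^ 16 * V + J * S) :=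
              mul_le_mul_of_nonneg_left hsumblocks (Nat.cast_nonneg _)
          _ ≤ (3 * L) * (K₁ / L ^ (A + 2) * ((V : ℝ) ^ 2 / 3) + K₂ * L ^ 16 * V + (3 * L) * S) := by
              apply mul_le_mul hJle _ hin0 (by positivity)
              gcongr
    _ = 3 * L * (K₁ / L ^ (A + 2) * ((V : ℝ) ^ 2 / 3)) + 3 * L * (K₂ * L ^ 16 * V) +
          3 * L * ((3 * L) * S) := by ring
    _ ≤ K₁ * X ^ 2 / L ^ A + 3 * K₂ * X ^ 2 / L ^ A + 162 * X ^ 2 / L ^ A := add_le_add (add_le_add t1 t2) t3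
    _ ≤ (K₁ + 3 * K₂ + 163) * X ^ 2 / Real.log X ^ A := by
        rw [← hL]
        have hX2 : 0 ≤ X ^ 2 / L ^ A := by positivity
        have : K₁ * X ^ 2 / L ^ A + 3 * K₂ * X ^ 2 / L ^ A + 162 * X ^ 2 / L ^ A =
            (K₁ + 3 * K₂ + 162) * (X ^ 2 / L ^ A) := by ring
        rw [this, show (K₁ + 3 * K₂ + 163) * X ^ 2 / L ^ A = (K₁ + 3 * K₂ + 163) * (X ^ 2 / L ^ A) by ring]
        nlinarith

end Summit.Parity.GeneralizedHardyLittlewood.Theorems
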